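import Summits.QuantumFields.BalabanUV.Beta.EriceFlowEnclosureB12AsPrintedUpper

/-!
# Beta / EriceFlowEnclosureB12AsPrintedTuned — Theorem 2's tuned runs read back through Theorem 3's printed conclusions, on the as-printed
# carrier of [I]: «Theorem 2 of [I] allows us to remove the assumption» ([Balaban1989LargeFieldII] p. 355) as a junction, and a necessary
# condition linking the unprinted Theorem 2 to the printed (5.10) (β-flow team, prover 1, unit `b2b-balaban-beta-bflow-p1`, gen 32; ROW AP-I;
# builds on `…B12AsPrintedUpper` §1 ∕ §4 and an4's row-D4 junction)

HONEST FRAMING (page 1 of everything the β sub-cell writes): discharging `BetaPertH` makes Bałaban's UV stability UNCONDITIONAL — a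
real constructive-QFT result; it is NOT the continuum limit and NOT the Clay problem.  HONEST DEPENDENCY (cell reorg 2026-08-19,
verbatim): «continuum YM on T⁴ ⇐ BetaPertH ∧ nine spine estimates (0/9 proved); BetaPertH ⇐ (D1) ∧ (D4) ∧ CAP+tail; G-an2-4 gates
asym, D1 and NE2/3/4.»  THIS MODULE DISCHARGES NOTHING: bookkeeping over the NAMED FIELDS of `B12BetaAsPrinted` ([I] = [Balaban1987RG1] as
typed, p537882 ✓ ∕ v1.1 p539116 ✓): `Theorem2Statement S hL` (Theorem 2 ∕ (0.31), STATED WITHOUT PROOF in print — a HYPOTHESIS here),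
`Definitions S`, `Conclusions S` (Theorem 3, PROVED in [I]+[II] by the author's account — HYPOTHESES here on an abstract `Setting`), plus ONE
located binder `hrg` (below).  Nothing of [I] is asserted; no field is claimed for Bałaban's objects.

THE BINDER `hrg : ∀ P, Step.InInterval S.γ P.K (S.cpl P) → FlowStep.RGEqH P.K S.β (S.cpl P)` — «inside the interval ]0, γ] the
construction's couplings obey (0.20)».  Print DEFINES g_{k+1} by (0.20) (p. 256 *"the coupling constant g_{k+1} is determined from the
equation (0.20)"*), so for the runs print speaks of this is automatic; the interface types (faithfully) only the FORWARD-DETERMINATION half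
`Definitions.d020` (if the right side is positive, g_{k+1} is its positive solution), from which (0.20) along a GIVEN run in the interval
does not follow (the interface is silent when the right side is not positive).  Hence a binder, displayed, never discharged here.

WHAT THIS FILE PROVES (0 sorry, 0 def):
§1 **`runHyp_of_theorem2Statement`** (`Theorem2Statement S hL` + `hrg` ⟹ for every m: ∃ γ₀ > 0 ∀ γ ≤ min(γ₀, S.γ) ∃ g₁ > 0 ∀ g ≤ g₁ ∃ 0 < β ≤ β′
   ∀ K ∃ g₀: **`RunHyp S ⟨K, m, g₀⟩`** ∧ run in ]0, γ] ∧ g_K = g ∧ (0.31) per step — Theorem 2's tuned runs ARE runs Theorem 3 speaks of: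
   B16 p. 355's sentence on this carrier); **`conclusions_along_tuned`** (+ `Definitions ∧ Conclusions`: along every tuned run
   |β_{j+1}(g₀, …, g_j)| ≤ β′₅₁₀ := betaPrime510 4 (C510·E₀) δ₁ for j + 1 ≤ K — an4's `abs_beta_prefix_le_betaPrime510` — and BOTH two-sided
   runnings hold: (0.31)'s and print's |·|-running `…B12AsPrintedUpper.discrete031_abs_of_conclusions`).
§2 `discrete031_combine` (two runnings combine: max of the lower constants, min of the upper), `lower_le_upper_of_discrete031` (K ≥ 1 ⟹ any
   lower constant ≤ any upper constant), **`theorem2_rate_le_betaPrime510`**: under the same hypotheses Theorem 2's constants satisfy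
   **β·ln L ≤ β′₅₁₀ = C510·E₀·Σ_x|x|₁²e^{−δ₁|x|₁}** (read at K = 1: β ln L ≤ 1∕g₀² − 1∕g² = β₁(g₀) ≤ β′₅₁₀) and (0.31)'s upper constant may be
   taken min(β′ ln L, β′₅₁₀) — THE RATE OF ASYMPTOTIC FREEDOM IN (0.31) CANNOT EXCEED THE VACUUM-POLARIZATION BOUND OF (5.10)∕(5.42): a
   consistency condition between the unprinted and the printed halves of the β binder.
NOT CLAIMED: `hrg` or any field of `B12BetaAsPrinted` for the construction; Theorem 2; `BetaPertH`; continuum; Clay.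
-/

namespace Summit.QuantumFields.BalabanUV.Beta.EriceFlowEnclosureB12AsPrintedTuned

open Literature.MathematicalPhysics.QuantumFieldTheory.Balaban1983to89
open Literature.MathematicalPhysics.QuantumFieldTheory.Balaban1983to89.B12BetaAsPrinted
open Literature.MathematicalPhysics.QuantumFieldTheory.Balaban1983to89.B12Sec2to5 (betaPrime510)
open Literature.MathematicalPhysics.QuantumFieldTheory.Balaban1983to89.FlowStep (prefixOf)
open Summit.QuantumFields.BalabanUV.Beta.B12AsPrintedRowD4Junction (abs_beta_prefix_le_betaPrime510)
open Summit.QuantumFields.BalabanUV.Beta.EriceFlowEnclosureB12AsPrintedUpper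

noncomputable section

variable {S : Setting}

/-! ## §1 Theorem 2's tuned runs ARE runs Theorem 3 speaks of — given that the construction's couplings obey (0.20) inside the interval -/

/-- **B16 p. 355 «Theorem 2 of [I] allows us to remove the assumption on the effective coupling constants», ON THE AS-PRINTED CARRIER.**
`Theorem2Statement S hL` together with the LOCATED BINDER `hrg` — *inside the interval ]0, γ] the construction's couplings obey (0.20)*
(print DEFINES g_{k+1} by (0.20), p. 256; the interface types only its forward-determination half `d020`, so the backward reading along a
given run is a binder here, not a consequence) — yields, for every torus exponent m, every γ ≤ min(γ₀, S.γ) and every small renormalized g,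
at EVERY K a bare coupling g₀ whose run satisfies THEOREM 3's RUN HYPOTHESIS `RunHyp S ⟨K, m, g₀⟩`, ends at g_K = g and obeys (0.31) per step.
[cite: Balaban1989LargeFieldII, Thm 1 p.355; Balaban1987RG1, Thm 2 (0.31) p.259, Thm 3 p.264] -/
theorem runHyp_of_theorem2Statement {hL : Odd S.L ∧ 1 < S.L} (h : Theorem2Statement S hL)
    (hrg : ∀ P : B12.RunParams, Step.InInterval S.γ P.K (S.cpl P) → FlowStep.RGEqH P.K S.β (S.cpl P)) (m : ℕ) :
    ∃ γ₀ : ℝ, 0 < γ₀ ∧ ∀ γ : ℝ, 0 < γ → γ ≤ γ₀ → γ ≤ S.γ → ∃ g₁ : ℝ, 0 < g₁ ∧ ∀ g : ℝ, 0 < g → g ≤ g₁ →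
      ∃ β β' : ℝ, 0 < β ∧ β ≤ β' ∧ ∀ K : ℕ, ∃ g₀ : ℝ,
        RunHyp S ⟨K, m, g₀⟩ ∧ Step.InInterval γ K (S.cpl ⟨K, m, g₀⟩) ∧ S.cpl ⟨K, m, g₀⟩ K = g ∧
          Step.Discrete031 (β * Real.log S.L) (β' * Real.log S.L) K g (S.cpl ⟨K, m, g₀⟩) := by
  obtain ⟨γ₀, hγ₀, hγ⟩ := tunedRuns_of_theorem2Statement h m
  refine ⟨γ₀, hγ₀, fun γ hγpos hγle hγS => ?_⟩
  obtain ⟨g₁, hg₁, hg⟩ := hγ γ hγpos hγle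
  refine ⟨g₁, hg₁, fun g hgpos hgle => ?_⟩
  obtain ⟨β, β', hβ, hββ', hK⟩ := hg g hgpos hgle
  refine ⟨β, β', hβ, hββ', fun K => ?_⟩
  obtain ⟨g₀, hI, hend, hD⟩ := hK K
  have hI' : Step.InInterval S.γ K (S.cpl ⟨K, m, g₀⟩) := fun k hk => ⟨(hI k hk).1, (hI k hk).2.trans hγS⟩
  exact ⟨g₀, ⟨hrg ⟨K, m, g₀⟩ hI', hI'⟩, hI, hend, hD⟩

/-- **… so THEOREM 3's PRINTED CONCLUSIONS APPLY TO THE TUNED FAMILY**: with `Definitions ∧ Conclusions`, along every tuned run the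
β-functions at the run's own histories obey print's uniform bound |β_{j+1}(g₀, …, g_j)| ≤ β′₅₁₀ := betaPrime510 4 (C510·E₀) δ₁ (j + 1 ≤ K), and the
run obeys BOTH two-sided runnings: Theorem 2's (0.31) (constants β ln L, β′ ln L) and print's |·|-running (constant β′₅₁₀).
[cite: Balaban1987RG1, Thm 2 (0.31) p.259 with Thm 3 p.264, (5.10) p.293 and (5.42) p.297] -/
theorem conclusions_along_tuned {hL : Odd S.L ∧ 1 < S.L} (h : Theorem2Statement S hL)
    (hrg : ∀ P : B12.RunParams, Step.InInterval S.γ P.K (S.cpl P) → FlowStep.RGEqH P.K S.β (S.cpl P))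
    (hD : Definitions S) (hC : Conclusions S) (m : ℕ) :
    ∃ γ₀ : ℝ, 0 < γ₀ ∧ ∀ γ : ℝ, 0 < γ → γ ≤ γ₀ → γ ≤ S.γ → ∃ g₁ : ℝ, 0 < g₁ ∧ ∀ g : ℝ, 0 < g → g ≤ g₁ →
      ∃ β β' : ℝ, 0 < β ∧ β ≤ β' ∧ ∀ K : ℕ, ∃ g₀ : ℝ,
        RunHyp S ⟨K, m, g₀⟩ ∧ S.cpl ⟨K, m, g₀⟩ K = g ∧
          (∀ j, j + 1 ≤ K → |S.β j (prefixOf (S.cpl ⟨K, m, g₀⟩) j)| ≤ betaPrime510 4 (S.C510 * S.E₀) S.δ₁) ∧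
          Step.Discrete031 (β * Real.log S.L) (β' * Real.log S.L) K g (S.cpl ⟨K, m, g₀⟩) ∧
          Step.Discrete031 (-betaPrime510 4 (S.C510 * S.E₀) S.δ₁) (betaPrime510 4 (S.C510 * S.E₀) S.δ₁) K g
            (S.cpl ⟨K, m, g₀⟩) := by
  obtain ⟨γ₀, hγ₀, hγ⟩ := runHyp_of_theorem2Statement h hrg m
  refine ⟨γ₀, hγ₀, fun γ hγpos hγle hγS => ?_⟩
  obtain ⟨g₁, hg₁, hg⟩ := hγ γ hγpos hγle hγS
  refine ⟨g₁, hg₁, fun g hgpos hgle => ?_⟩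
  obtain ⟨β, β', hβ, hββ', hK⟩ := hg g hgpos hgle
  refine ⟨β, β', hβ, hββ', fun K => ?_⟩
  obtain ⟨g₀, hR, -, hend, hD031⟩ := hK K
  have hP := discrete031_abs_of_conclusions hD hC hR
  rw [show (⟨K, m, g₀⟩ : B12.RunParams).K = K from rfl, hend] at hP
  exact ⟨g₀, hR, hend, fun j hj => abs_beta_prefix_le_betaPrime510 hD hC hR hj, hD031, hP⟩

/-! ## §2 A necessary condition linking the unprinted Theorem 2 to the printed (5.10): the rate of asymptotic freedom cannot exceed the
vacuum-polarization bound -/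

/-- Two discrete runnings of one run combine: the lower constants by `max`, the upper by `min`. [folklore] -/
theorem discrete031_combine {b₁ b₁' b₂ b₂' : ℝ} {K : ℕ} {g : ℝ} {gs : ℕ → ℝ}
    (h₁ : Step.Discrete031 b₁ b₁' K g gs) (h₂ : Step.Discrete031 b₂ b₂' K g gs) :
    Step.Discrete031 (max b₁ b₂) (min b₁' b₂') K g gs := by
  intro k hk
  have a := h₁ k hk
  have b := h₂ k hk
  have hKk : (0 : ℝ) ≤ (K : ℝ) - k := by
    have : (k : ℝ) ≤ K := by exact_mod_cast hk
    linarith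
  constructor
  · rcases le_total b₁ b₂ with hle | hle
    · rw [max_eq_right hle]; exact b.1
    · rw [max_eq_left hle]; exact a.1
  · rcases le_total b₁' b₂' with hle | hle
    · rw [min_eq_left hle]; exact a.2
    · rw [min_eq_right hle]; exact b.2

/-- The lower constant of a discrete running over at least one step is at most the upper one of any other: `b·1 ≤ 1∕g₀² − 1∕g² ≤ c·1`
at k = K − 1 … here read at k = 0 with K ≥ 1: `b·K ≤ c·K`. [folklore] -/
theorem lower_le_upper_of_discrete031 {b b' c c' : ℝ} {K : ℕ} (hK : 1 ≤ K) {g : ℝ} {gs : ℕ → ℝ}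
    (h₁ : Step.Discrete031 b b' K g gs) (h₂ : Step.Discrete031 c c' K g gs) : b ≤ c' := by
  have a := (h₁ 0 (Nat.zero_le K)).1
  have d := (h₂ 0 (Nat.zero_le K)).2
  have hKpos : (0 : ℝ) < (K : ℝ) - 0 := by
    have : (1 : ℝ) ≤ K := by exact_mod_cast hK
    linarith
  nlinarith

/-- **THEOREM 2's LOWER CONSTANT IS BOUNDED BY PRINT's (5.10) CONSTANT.**  If `Theorem2Statement S hL` holds, the construction's couplings obey
(0.20) inside the interval (`hrg`), and the printed `Definitions ∧ Conclusions` hold, then for every m, every admissible γ, g, the constants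
0 < β ≤ β′ that Theorem 2 provides satisfy **β·ln L ≤ β′₅₁₀ = C510·E₀·Σ_x|x|₁²e^{−δ₁|x|₁}** — the rate of asymptotic freedom in (0.31) can be no
larger than the uniform bound on |β_{j+1}| that [I]+[II] prove from the vacuum-polarization decay (5.10) (read at K = 1: β ln L ≤ 1∕g₀² − 1∕g² =
β₁(g₀) ≤ β′₅₁₀); and (0.31)'s upper constant may be replaced by min(β′ ln L, β′₅₁₀).  A CONSISTENCY CONDITION between the unprinted and the
printed halves of the β binder, nothing more. [cite: Balaban1987RG1, Thm 2 (0.31) p.259 with (5.10) p.293, (5.42) p.297 and Thm 3 p.264] -/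
theorem theorem2_rate_le_betaPrime510 {hL : Odd S.L ∧ 1 < S.L} (h : Theorem2Statement S hL)
    (hrg : ∀ P : B12.RunParams, Step.InInterval S.γ P.K (S.cpl P) → FlowStep.RGEqH P.K S.β (S.cpl P))
    (hD : Definitions S) (hC : Conclusions S) (m : ℕ) :
    ∃ γ₀ : ℝ, 0 < γ₀ ∧ ∀ γ : ℝ, 0 < γ → γ ≤ γ₀ → γ ≤ S.γ → ∃ g₁ : ℝ, 0 < g₁ ∧ ∀ g : ℝ, 0 < g → g ≤ g₁ →
      ∃ β β' : ℝ, 0 < β ∧ β ≤ β' ∧ β * Real.log S.L ≤ betaPrime510 4 (S.C510 * S.E₀) S.δ₁ ∧ ∀ K : ℕ, ∃ g₀ : ℝ,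
        RunHyp S ⟨K, m, g₀⟩ ∧ S.cpl ⟨K, m, g₀⟩ K = g ∧
          Step.Discrete031 (β * Real.log S.L) (min (β' * Real.log S.L) (betaPrime510 4 (S.C510 * S.E₀) S.δ₁)) K g
            (S.cpl ⟨K, m, g₀⟩) := by
  obtain ⟨γ₀, hγ₀, hγ⟩ := conclusions_along_tuned h hrg hD hC m
  refine ⟨γ₀, hγ₀, fun γ hγpos hγle hγS => ?_⟩
  obtain ⟨g₁, hg₁, hg⟩ := hγ γ hγpos hγle hγS
  refine ⟨g₁, hg₁, fun g hgpos hgle => ?_⟩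
  obtain ⟨β, β', hβ, hββ', hK⟩ := hg g hgpos hgle
  have hrate : β * Real.log S.L ≤ betaPrime510 4 (S.C510 * S.E₀) S.δ₁ := by
    obtain ⟨g₀, -, -, -, h1, h2⟩ := hK 1
    exact lower_le_upper_of_discrete031 le_rfl h1 h2
  refine ⟨β, β', hβ, hββ', hrate, fun K => ?_⟩
  obtain ⟨g₀, hR, hend, -, h1, h2⟩ := hK K
  refine ⟨g₀, hR, hend, ?_⟩
  have hc := discrete031_combine h1 h2
  have hmax : max (β * Real.log S.L) (-betaPrime510 4 (S.C510 * S.E₀) S.δ₁) = β * Real.log S.L := by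
    refine max_eq_left ?_
    have hlog : 0 < Real.log (S.L : ℝ) := Real.log_pos (by exact_mod_cast hL.2)
    have : 0 ≤ betaPrime510 4 (S.C510 * S.E₀) S.δ₁ := hrate.trans' (mul_pos hβ hlog).le
    linarith [mul_pos hβ hlog]
  rw [hmax] at hc
  exact hc

end

end Summit.QuantumFields.BalabanUV.Beta.EriceFlowEnclosureB12AsPrintedTuned
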